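import Summits.QuantumFields.YangMills.Theorems.ContractibleFibreFibreToTorusStubTorusLimitTranslationInvariant
import Literature.MathematicalPhysics.QuantumLattice.LatticeGaugeDLRGibbsProofs
import Literature.MathematicalPhysics.QuantumLattice.LatticeGaugeDLRLimitPointsProofs
import HarnessLib

/-!
# Translation-invariant lattice Yang–Mills Gibbs states exist at every coupling

Helper file of crux `FibreToTorus` (stmt-QuantumFields-16244), line `Sketch` (energy/tangent programme, step G1 of the converse
"kink ⇒ energy coexistence"): at every `β` the Wilson specification of a compact Hausdorff second-countable group in a continuous
matrix representation has a translation-invariant probability DLR state — any periodic infinite-volume limit point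
(`infiniteVolumeLimitPoints_nonempty_holds`, DLR by `mem_ymGibbsMeasures_of_mem_infiniteVolumeLimitPoints_holds`, invariant by
`stub_torusLimitTranslationInvariant`).  Makes the statements PTU / U_tr / NS visibly non-vacuous.
-/

noncomputable section

open MeasureTheory
open Literature.MathematicalPhysics.QuantumLattice (LGConfig ymGibbsMeasures IsZdTranslationInvariant infiniteVolumeLimitPoints
  infiniteVolumeLimitPoints_nonempty_holds mem_ymGibbsMeasures_of_mem_infiniteVolumeLimitPoints_holds)

namespace Summit.QuantumFields.YangMills.Theorems.FibreToTorus

/-- **Translation-invariant DLR states exist at every coupling** (registered helper sub-goal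
`kink_exists_translationInvariant_ymGibbsMeasure`): a periodic infinite-volume limit point of the torus Wilson states is a
probability DLR state invariant under all lattice translations. [cite: Georgii2011, Thm. 4.17] -/
theorem kink_exists_translationInvariant_ymGibbsMeasure : ∀ (d N : ℕ) (G : Type) [Group G] [TopologicalSpace G] [IsTopologicalGroup G] [CompactSpace G] [MeasurableSpace G] [BorelSpace G] [T2Space G] [SecondCountableTopology G] (ρ : G →* Matrix (Fin N) (Fin N) ℂ), Continuous ρ → ∀ β : ℝ, ∃ μ : MeasureTheory.Measure (LGConfig d G), μ ∈ ymGibbsMeasures (d := d) ρ β ∧ MeasureTheory.IsProbabilityMeasure μ ∧ IsZdTranslationInvariant μ := by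
  intro d N G _ _ _ _ _ _ _ _ ρ hρ β
  obtain ⟨μ, hμ⟩ := infiniteVolumeLimitPoints_nonempty_holds (d := d) ρ hρ β
  have hμ' := hμ
  obtain ⟨L, -, hprob, -⟩ := hμ'
  exact ⟨μ, mem_ymGibbsMeasures_of_mem_infiniteVolumeLimitPoints_holds (d := d) ρ hρ hμ, hprob,
    stub_torusLimitTranslationInvariant d N G ρ hρ β μ hμ⟩

end Summit.QuantumFields.YangMills.Theorems.FibreToTorus

end
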